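import Summits.ABC.IUTFork.Cor312RamifiedIsmBarrier
import HarnessLib

/-!
# [IUTchIII] Cor. 3.12 — the RAMIFIED SHEAR bed, VI: the DEPTH-ONE criterion — which readings of Ism reach the typed Corollary at `m = 1`

Record-only file (D-0012; PROOF-ONLY: no definition, no `Prop` fact, nothing asserted about print) of the abc-iut cell, IUT REPAIR BRANCH (rung
LADDER-ABC:A2.RP), seat abc-iut-rp-m1 (gen 3; class (ii)). TAKES NO SIDE on [IUTchIII] Cor. 3.12. Sequel to `Cor312RamifiedIsmBarrier` (RAM_{G₁,G₂}(p, m) for an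
ARBITRARY reading `1 ∈ Gᵢ ⊆ GL(I)` of the strip-automorphisms / Ism; `not_statementWith`: at depth `m ≥ 2` no reading rescues the typed Corollary;
`thetaHullWith_sandwich`: `ⁿ˒°𝒰_j = box K_j` with `2⌈(m·j² − j − 1)/2⌉ ≤ K_j ≤ m·j²`).

At the ONE depth left open by the barrier, `m = 1` (`q = π`), this file says exactly which readings reach the typed inequality:
* `negLogThetaWith_eq` — for every reading, `−|log(Θ)| = −((K₁ + K₂)/4)·log p` with the sandwich indices `K₁ ∈ [hullExp m 2, m]`, `K₂ ∈ [4m − 2, 4m]` of the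
  two labels;
* **`statementWith_one_iff_full_inflation`** — at `m = 1`: Statement ⟺ `ⁿ˒°𝒰₁ = box 0 ∧ ⁿ˒°𝒰₂ = box 2`, i.e. iff the reading inflates BOTH labels MAXIMALLY (as far as
  `GL(I)` does: `box 1 ↦ box 0 = 𝒪_L`, `box 4 ↦ box 2`); any reading that leaves one label short (e.g. every ISOMETRIC reading: no inflation at all,
  `Repair/CandMochizuki7RamIsometric`) fails;
* **`thetaHullWith_eq_of_swap_mem` / `statementWith_iff_of_swap_mem`** — every reading whose Ism contains the swap `1 ↔ π` has RAM's full hull at every label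
  and every depth, hence the SAME typed verdict as RAM (`⟺ m = 1` for `m ≥ 1`): the single non-isometric mover already buys everything `GL(I)` buys.
READING (neutral): on the ramified toy, «how much un-rigidifying» matters only through whether a valuation-LOWERING lattice automorphism (a `1 ↔ π`-type mover) is
admitted, and even then only at the shallowest datum. Interface-level; no verdict on print. [claim: Mochizuki2012, status: disputed]
-/

noncomputable section

namespace Summit.ABC.IUTFork.Cor312Vol.RamifiedWitness

open Set Thm311 Cor312 Cor312.Checks Cor312.IdentifiedNonVacuity NaiveWitness PinnedWitness Literature.IUT.LogThetaLattice

variable (p : ℕ) {G₁ G₂ : Set ((Fin 2 → ℚ) ≃ₗ[ℚ] (Fin 2 → ℚ))}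
  (h₁ : LinearEquiv.refl ℚ (Fin 2 → ℚ) ∈ G₁) (h₂ : LinearEquiv.refl ℚ (Fin 2 → ℚ) ∈ G₂) [hp : Fact p.Prime] (m : ℕ)
  (hG₁ : G₁ ⊆ latticeAuts p) (hG₂ : G₂ ⊆ latticeAuts p)

/-! ## 1. `−|log(Θ)|` of a reading in terms of its two hull indices -/

include hG₁ hG₂ in
/-- The hull index of a reading at `(j, v_ℚ)`: `ⁿ˒°𝒰 = box K`, `hullExp ≤ K ≤ m·j²`, and the local Θ-term is `−(K/2)·log p`. [folklore] -/
theorem thetaHullWith_index (j : toyIndex.Label) (vQ : toyIndex.VQ) :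
    ∃ K : ℤ, (ramSettingWith p G₁ G₂ h₁ h₂ m).thetaHull j vQ = box p j vQ K ∧ hullExp ((m : ℤ) * jsq j) ((j : ℕ) + 1 : ℕ) ≤ K ∧ K ≤ (m : ℤ) * jsq j ∧
      (ramSettingWith p G₁ G₂ h₁ h₂ m).thetaLocal j vQ = ((-((K : ℝ) / 2) * Real.log p : ℝ) : WithTop ℝ) := by
  obtain ⟨K, hK, h1, h2⟩ := thetaHullWith_sandwich p h₁ h₂ m hG₁ hG₂ j vQ
  refine ⟨K, hK, h1, h2, ?_⟩
  unfold Setting.thetaLocal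
  rw [if_pos (ramSettingWith_hullDefined p h₁ h₂ m hG₁ hG₂ j vQ)]
  show ((rVol p j vQ ((rFrame p j vQ).hull ((ramSettingWith p G₁ G₂ h₁ h₂ m).thetaHull j vQ)) : ℝ) : WithTop ℝ) = _
  rw [hK, rFrame_hull_box, rVol_box]

include hG₁ hG₂ in
/-- **`−|log(Θ)| = −((K₁ + K₂)/4)·log p`** for the hull indices `K₁`, `K₂` of the two labels (`vQ` the unique place). [folklore] -/
theorem negLogThetaWith_eq :
    ∃ K₁ K₂ : ℤ, (ramSettingWith p G₁ G₂ h₁ h₂ m).thetaHull 1 () = box p 1 () K₁ ∧ (ramSettingWith p G₁ G₂ h₁ h₂ m).thetaHull 2 () = box p 2 () K₂ ∧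
      hullExp m 2 ≤ K₁ ∧ K₁ ≤ m ∧ 4 * (m : ℤ) - 2 ≤ K₂ ∧ K₂ ≤ 4 * m ∧
      (ramSettingWith p G₁ G₂ h₁ h₂ m).negLogTheta = ((-(((K₁ + K₂ : ℤ) : ℝ)) / 4 * Real.log p : ℝ) : WithTop ℝ) := by
  have hj1 : jsq (1 : toyIndex.Label) = 1 := rfl
  have hj2 : jsq (2 : toyIndex.Label) = 4 := rfl
  have hn1 : (((1 : toyIndex.Label) : ℕ) + 1 : ℕ) = 2 := rfl
  have hn2 : (((2 : toyIndex.Label) : ℕ) + 1 : ℕ) = 3 := rfl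
  obtain ⟨K₁, hK₁, h1₁, h2₁, hloc₁⟩ := thetaHullWith_index p h₁ h₂ m hG₁ hG₂ 1 ()
  obtain ⟨K₂, hK₂, h1₂, h2₂, hloc₂⟩ := thetaHullWith_index p h₁ h₂ m hG₁ hG₂ 2 ()
  rw [hj1, hn1, mul_one] at h1₁
  rw [hj1, mul_one] at h2₁
  rw [hj2, hn2] at h1₂
  rw [hj2] at h2₂
  push_cast at h1₁ h1₂ h2₂
  have he2 : hullExp ((m : ℤ) * 4) 3 = 4 * m - 2 := by unfold hullExp; omega
  rw [he2] at h1₂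
  refine ⟨K₁, K₂, hK₁, hK₂, h1₁, h2₁, h1₂, by linarith, ?_⟩
  unfold Setting.negLogTheta
  rw [if_pos (ramSettingWith_thetaFinite p h₁ h₂ m hG₁ hG₂)]
  congr 1
  unfold processionNormalized
  have hl1 : (Setting.labelSucc ((0 : Fin 2) : Fin toyIndex.lstar) : toyIndex.Label) = 1 := rfl
  have hl2 : (Setting.labelSucc ((1 : Fin 2) : Fin toyIndex.lstar) : toyIndex.Label) = 2 := rfl
  have hd : (default : toyIndex.VQ) = () := rfl
  show (∑ i : Fin 2, ∑ᶠ vQ : toyIndex.VQ, ((ramSettingWith p G₁ G₂ h₁ h₂ m).thetaLocal (Setting.labelSucc i) vQ).untopD 0) / ((2 : ℕ) : ℝ) = _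
  rw [Fin.sum_univ_two, finsum_unique, finsum_unique, hd, hl1, hl2, hloc₁, hloc₂, WithTop.untopD_coe, WithTop.untopD_coe]
  push_cast
  ring

/-! ## 2. Depth one: the typed Corollary holds iff BOTH labels are maximally inflated -/

include hG₁ hG₂ in
/-- **At `m = 1`, for EVERY reading inside `GL(I)`: Statement ⟺ `ⁿ˒°𝒰₁ = box 0 ∧ ⁿ˒°𝒰₂ = box 2`** (both labels inflated as far as `GL(I)` inflates them).
[claim: Mochizuki2012, status: disputed] -/
theorem statementWith_one_iff_full_inflation :
    (ramSettingWith p G₁ G₂ h₁ h₂ 1).Statement ↔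
      (ramSettingWith p G₁ G₂ h₁ h₂ 1).thetaHull 1 () = box p 1 () 0 ∧ (ramSettingWith p G₁ G₂ h₁ h₂ 1).thetaHull 2 () = box p 2 () 2 := by
  obtain ⟨K₁, K₂, hK₁, hK₂, h1₁, h2₁, h1₂, h2₂, hΘ⟩ := negLogThetaWith_eq p h₁ h₂ 1 hG₁ hG₂
  have he1 : hullExp ((1 : ℕ) : ℤ) 2 = 0 := by unfold hullExp; omega
  rw [he1] at h1₁
  push_cast at h2₁ h1₂ h2₂
  have hL := log_p_pos p
  unfold Setting.Statement
  rw [hΘ, ramSettingWith_negLogQ, WithTop.coe_le_coe, hK₁, hK₂]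
  constructor
  · rintro ⟨-, h⟩
    have h3 : ((K₁ + K₂ : ℤ) : ℝ) ≤ 2 := by
      push_cast at h ⊢
      nlinarith
    have hsum' : K₁ + K₂ ≤ 2 := by exact_mod_cast h3
    have hK1 : K₁ = 0 := by omega
    have hK2 : K₂ = 2 := by omega
    rw [hK1, hK2]
    exact ⟨rfl, rfl⟩
  · rintro ⟨ha, hb⟩
    have hK1 : K₁ = 0 := box_injective 1 () ha
    have hK2 : K₂ = 2 := box_injective 2 () hb
    refine ⟨WithTop.coe_ne_top, ?_⟩
    rw [hK1, hK2]
    push_cast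
    nlinarith

/-! ## 3. Readings containing the swap `1 ↔ π` have RAM's full hull, hence RAM's verdict -/

omit hp in
/-- If Ism contains the swap, the swap family is an (Ind2)-family of the reading. [folklore] -/
theorem swapFam_mem_Ind2FamilyWith (hsw : swap2 ∈ G₂) : swapFam p ∈ (ramShellsWith p G₁ G₂ h₁ h₂).Ind2Family := fun _ _ =>
  ⟨fun _ _ => swap2, fun _ _ => hsw, rfl⟩

include hG₁ hG₂ in
/-- **A reading whose Ism contains the swap has RAM's FULL hull `box(2⌈(m·j² − j − 1)/2⌉)` at every label** (upper bound: the barrier's sandwich; lower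
bound: the swap mover). [claim: Mochizuki2012, status: disputed] -/
theorem thetaHullWith_eq_of_swap_mem (hsw : swap2 ∈ G₂) (j : toyIndex.Label) (vQ : toyIndex.VQ) :
    (ramSettingWith p G₁ G₂ h₁ h₂ m).thetaHull j vQ = box p j vQ (hullExp ((m : ℤ) * jsq j) ((j : ℕ) + 1 : ℕ)) := by
  obtain ⟨K, hK, h1, -⟩ := thetaHullWith_sandwich p h₁ h₂ m hG₁ hG₂ j vQ
  rw [hK]
  congr 1
  refine le_antisymm ?_ h1
  -- the swap point `p^{hullExp/2}·e_{1…1}` lies in the union of possible images of the reading, hence in `ⁿ˒°𝒰 = box K`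
  have hmem : (p : ℚ) ^ (hullExp ((m : ℤ) * jsq j) ((j : ℕ) + 1 : ℕ) / 2) • tb p j vQ (zeros j) ∈
      (⋃₀ (ramSettingWith p G₁ G₂ h₁ h₂ m).possibleImages j vQ : Set ((ramSituationWith p G₁ G₂ h₁ h₂).L.Packet j vQ)) := by
    have hb := hullExp_bounds ((m : ℤ) * jsq j) ((j : ℕ) + 1 : ℕ)
    refine ⟨swapFam p j vQ '' box p j vQ ((m : ℤ) * jsq j),
      ⟨swapFam p, Subgroup.subset_closure (Or.inr (swapFam_mem_Ind2FamilyWith p h₁ h₂ hsw)), by rw [ramSettingWith_thetaRegion3]; rfl⟩,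
      (p : ℚ) ^ (hullExp ((m : ℤ) * jsq j) ((j : ℕ) + 1 : ℕ) / 2) • tb p j vQ (ones j), ?_, ?_⟩
    · rw [ppow_smul_tb_mem_box_iff, wt_ones]; unfold hullExp; omega
    · rw [map_smul, swapFam_tb, swap_ones]
  have hin : (p : ℚ) ^ (hullExp ((m : ℤ) * jsq j) ((j : ℕ) + 1 : ℕ) / 2) • tb p j vQ (zeros j) ∈ box p j vQ K := by
    rw [← hK]
    exact (rFrame p j vQ).subset_hull _ hmem
  rw [ppow_smul_tb_mem_box_iff, wt_zeros] at hin
  have hb := hullExp_bounds ((m : ℤ) * jsq j) ((j : ℕ) + 1 : ℕ)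
  omega

include hG₁ hG₂ in
/-- … hence the SAME `−|log(Θ)|` as RAM … [folklore] -/
theorem negLogThetaWith_eq_of_swap_mem (hsw : swap2 ∈ G₂) :
    (ramSettingWith p G₁ G₂ h₁ h₂ m).negLogTheta = (ramSetting p m).negLogTheta := by
  obtain ⟨K₁, K₂, hK₁, hK₂, -, -, -, -, hΘ⟩ := negLogThetaWith_eq p h₁ h₂ m hG₁ hG₂
  have e1 := thetaHullWith_eq_of_swap_mem p h₁ h₂ m hG₁ hG₂ hsw 1 ()
  have e2 := thetaHullWith_eq_of_swap_mem p h₁ h₂ m hG₁ hG₂ hsw 2 ()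
  rw [hK₁] at e1
  rw [hK₂] at e2
  have hk1 : K₁ = hullExp ((m : ℤ) * jsq (1 : toyIndex.Label)) (((1 : toyIndex.Label) : ℕ) + 1 : ℕ) := box_injective 1 () e1
  have hk2 : K₂ = hullExp ((m : ℤ) * jsq (2 : toyIndex.Label)) (((2 : toyIndex.Label) : ℕ) + 1 : ℕ) := box_injective 2 () e2
  have hj1 : jsq (1 : toyIndex.Label) = 1 := rfl
  have hj2 : jsq (2 : toyIndex.Label) = 4 := rfl
  have hn1 : (((1 : toyIndex.Label) : ℕ) + 1 : ℕ) = 2 := rfl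
  have hn2 : (((2 : toyIndex.Label) : ℕ) + 1 : ℕ) = 3 := rfl
  rw [hj1, hn1, mul_one] at hk1
  rw [hj2, hn2] at hk2
  push_cast at hk1 hk2
  have he2 : hullExp ((m : ℤ) * 4) 3 = 4 * m - 2 := by unfold hullExp; omega
  rw [he2] at hk2
  rw [hΘ, ramSetting_negLogTheta, hk1, hk2]
  congr 1
  ring

include hG₁ hG₂ in
/-- **… and the SAME typed verdict as RAM: for a reading whose Ism contains the swap, Statement ⟺ RAM's Statement** (so `⟺ m = 1` for `m ≥ 1`).
[claim: Mochizuki2012, status: disputed] -/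
theorem statementWith_iff_of_swap_mem (hsw : swap2 ∈ G₂) : (ramSettingWith p G₁ G₂ h₁ h₂ m).Statement ↔ (ramSetting p m).Statement := by
  unfold Setting.Statement
  rw [negLogThetaWith_eq_of_swap_mem p h₁ h₂ m hG₁ hG₂ hsw, ramSettingWith_negLogQ, ramSetting_negLogQ]

include hG₁ hG₂ in
/-- In particular such a reading reaches the typed Corollary at `m = 1` (attained) and at no other depth `m ≥ 1`. [claim: Mochizuki2012, status: disputed] -/
theorem statementWith_iff_eq_one_of_swap_mem (hsw : swap2 ∈ G₂) (hm : 1 ≤ m) : (ramSettingWith p G₁ G₂ h₁ h₂ m).Statement ↔ m = 1 := by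
  rw [statementWith_iff_of_swap_mem p h₁ h₂ m hG₁ hG₂ hsw, ramSetting_statement_iff p m hm]

end Summit.ABC.IUTFork.Cor312Vol.RamifiedWitness

end
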